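import Summits.QuantumFields.YangMills.Theorems.UnitScaleTiltProp8ChartBasePointGaugeLine
import Summits.QuantumFields.YangMills.Theorems.BalabanUVNodesK0Stub1PairingsAtExtensions
import Summits.QuantumFields.YangMills.Theorems.BalabanUVNodesK0Stub1MultiplierLetterP
import HarnessLib

/-!
# K0⁷ STUB 1 (`stub_prop8StepCoP13`), sub-target S4b — LOCATED-BASEPOINT vs S4b, the certified half:
# **THE COLUMN LETTER `q₀` OF A TRANSPOSE OF THE SINGLE-BAR LINEARISATION `Qlin = D(chartLog η D)(0)` IS BOUNDED BELOW BY THE BASE-POINT MODE** —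
# for ANY `Qt` with `BE (Qt X) δ = B X (Qlin δ)` (the (27)∕block-trace transposition of the S4b capstone `K0Stub1SectFWSlotAtRecord`) and ANY numbers `(q₀, wB′)` satisfying
# the capstone's displayed letter `hQt'` (`(∀ i, wB′ i·‖X i‖ ≤ s) → ∀ b, w₃ b·‖Qt X b‖ ≤ q₀·s`): `(min_{b ∋ y₀} w₃ b)·‖τ(E·M)‖ ≤ 2d·|η|^{d−1}·(q₀·wB′ i)·‖E‖·‖M‖` at every
# index `i` hierarchically centred over a fine site `y₀`; at a top-level centre of the record (`w₃ = 1`, `τ 1 = 1`): `q₀·wB′(i)·2d·|η|^{d−1} ≥ 1`, i.e. `q₀·wB′(i) ≥ L^{3k}∕8` at d = 4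

Cell `pub-ymgap`, width seat `pub-ymgap-k0-s1-w2` g4 (CLAIM-2, certified half).  `--kind proof --supports stmt-QuantumFields-20541 --as helper`; count-neutral; def-free.
[15] = [Balaban1985Variational]; [B7] = [Balaban1985Averaging].

WHY.  ★★OWNER ym3-torus-plan g26's FYI on this cell's bus (2026-08-28 06:34Z): on the single-bar chart `chartLog η D` the base-point gauge mode
`V = η⁻¹M(𝟙_{b₋=y₀} − 𝟙_{b₊=y₀})` is answered by the LINEAR chart with the O(1) coarse pure gauge `M` at every index centred over `y₀` (certified:
`ChartBasePointGaugeLine.fderiv_chartLog_zero_gaugeDir_src`), so KERNEL ∕ TRANSPOSED rows of the single-bar linearisation and remainder are NOT volume-suppressed at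
the `2d` base-point bonds, while sup-operator letters are fine; «if any of your nodes consumes a transposed∕kernel row … check it against the base-point witness».
The S4b capstone at the record (`K0Stub1SectFWSlotAtRecord.exists_sectF_W_atRecord_of_numericLetters`, p612123) displays two such rows among its four numbers:
`q₀` (the column letter `hQt'` of `Qᵗ`, with `Q := Qlin` in the headline edition) and `θ₀` (`h73t`, the column letter of `𝔇(A′)ᵗ`).  THIS FILE is the check for
`q₀`, first order, from tree theorems only: pair the transposition identity `hQt` against `V` with the one-index datum `X = δ_i·E`; the right side is `τ(E·M)` by the
base-point identity, the left side is `η^d·Σ_b τ((Qt X)_b·V_b)`, supported on the `2d` bonds at `y₀`, each bounded through `hQt'` by `q₀·wB′(i)·‖E‖∕w₃(b)`.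
Consequence recorded in the docstrings (numbers, not adjectives): at a top-level hierarchical centre of an admissible family of the record (`w₃ ≡ 1` on the `2d`
bonds by `IsLevWeight`, fibre `M_N(ℂ)` with the normalised trace, `E = M = 1`, `d = 4`, `η = L^{−k}`) any admissible `q₀` has `q₀·wB′(i) ≥ L^{3k}∕8`; since the
multiplier band of k0-s1-w4's `h3132_of_adm22_T4` caps `wB′(i) ≤ (Lᵏη)⁻¹ = 1` there, the headline edition `Q := Qlin` admits NO k-uniform `q₀`.  (The `_anyQ`
edition with a democratic average — the flat straight `Q_V = QE D` — is untouched; `θ₀` is the second-order twin, LOCATED on the bus, not certified here.)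

WHAT IS PROVED (sorry-free; no definition; axioms standard; every torus `P`, every complete normed `ℂ`-algebra `𝔸`, every nested family `D`, `η ≠ 0`).
* §1 `sum_ite_src_eq`, `sum_ite_tgt_eq` — `Σ_b [b₋ = y₀]·c = d·c`, `Σ_b [b₊ = y₀]·c = d·c` (bond ≃ site × direction; translation is a bijection).
* §1 `norm_gaugeDir_le` — `‖V b‖ ≤ |η|⁻¹‖M‖·([b₋ = y₀] + [b₊ = y₀])`.
* §2 ★★ `qt_basePoint_bound` — the displayed inequality `m·‖τ(E·M)‖ ≤ 2d·|η|^{d−1}·(q₀·wB′ i)·‖E‖·‖M‖` (`m ≤ w₃` on the `2d` bonds at `y₀`, `m > 0`, `wB′ ≥ 0`,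
  `τ` contractive).
* §2 ★ `q0_mul_weight_ge_of_unit_weights` — corollary: `w₃ = 1` on the `2d` bonds, `τ 1 = 1` ⇒ `1 ≤ 2d·|η|^{d−1}·(q₀·wB′ i)`.
* §3 ★ `q0_mul_weight_ge_at_top_territory` — the record reading: P2 level weights `IsLevWeight P k D w` (`w m b = (L^{j(b)}η)^m`), `y₀` and its `d` lattice
  predecessors in the top territory `Ω_k` ⇒ `1 ≤ 2d·((L⁻¹)^k)^{d−1}·(q₀·wB′ i)` for `w₃ := w 3` (k0-s1-w4's `levWeight_eq_one_of_inOm_top`).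
HONEST SCOPE.  A certified LOWER BOUND on one displayed numeric letter of p612123 (an implication whose hypotheses are the capstone's own displayed shapes); nothing
landed is claimed false; the second-order statement about `θ₀` and the size of `W` at base-point bonds are LOCATED readings on the bus, NOT proved here; which average
`Q` road R0′ puts in the multiplier term is the planners'; `stub_prop8StepCoP13` ∕ K0⁷ NOT closed; N07 NOT discharged; counts unmoved (28∕28 · 5∕27); one finite 𝕋⁴
programme at fixed ε — R4 closes the conditional finite-𝕋⁴ rung `BalabanLadder.UV` only, never the summit; the YM mass gap (Clay) is NOT proved by any of this;
nothing continuum ∕ ℝ⁴ ∕ OS.  No `sorry`, no `def`, no `instance`, no `notation`.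

References: [15] (27) p.282, (44)–(47) p.285, (66) p.287, (88)–(90) pp.291–292, Prop. 4 (97)–(98) pp.292–293; [B7] (8)–(11) pp.18–19, (89) p.31, (125) p.36, (147)∕(157)
pp.40–42; [Balaban1987RG1] (0.1), (0.4) pp.251–253.
-/

set_option autoImplicit false

noncomputable section

open scoped BigOperators

namespace Summit.QuantumFields.YangMills.Theorems.K0Stub1QlinTransposeBasePoint

open Literature.MathematicalPhysics.QuantumFieldTheory.Balaban1983to89
open B6SectADomainsV1 (Domains)
open B6SectAOperatorsV1 (BondIdx)
open B15DeterminingSets (embIter)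
open B9Eq39Adjoint (bondPair)
open B10StarCount (shift_unshift unshift_shift)
open Summit.QuantumFields.YangMills.Theorems.Prop8Chart (chartLog)
open Summit.QuantumFields.YangMills.Theorems.ChartBasePointGaugeLine (fderiv_chartLog_zero_gaugeDir_src)
open Summit.QuantumFields.YangMills.Theorems.K0Stub1PairingsAtExtensions (bondPair_PBond_eq_sum)
open Summit.QuantumFields.YangMills.Theorems.K0FlatCubeOpsTextP (IsLevWeight)
open Summit.QuantumFields.YangMills.Theorems.K0Stub1MultiplierLetterP (levWeight_eq_one_of_inOm_top)

variable {P : Params} {𝔸 : Type*} [NormedRing 𝔸] [NormedAlgebra ℂ 𝔸] [CompleteSpace 𝔸]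

/-! ## §1  Counting the `2d` bonds at a site; the size of the base-point mode -/

/-- `Σ_b [b₋ = y₀]·c = d·c`: the bonds issuing from `y₀` are the `d` pairs `(y₀, μ)`. [folklore] -/
theorem sum_ite_src_eq (y₀ : Site P 0) (c : ℝ) :
    ∑ b : PBond P 0, (if b.src = y₀ then c else 0) = (P.d : ℝ) * c := by
  classical
  rw [← Fintype.sum_equiv (LatticeFieldCalculus.bondEquiv (P := P) (j := 0)) (fun p => if p.1 = y₀ then c else 0) _ (fun _ => rfl),
    Fintype.sum_prod_type]
  dsimp only
  rw [Finset.sum_comm]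
  simp only [Finset.sum_ite_eq', Finset.mem_univ, if_true, Finset.sum_const, Finset.card_univ, Fintype.card_fin, nsmul_eq_mul]

/-- `Σ_b [b₊ = y₀]·c = d·c`: the bonds ending at `y₀` are the `d` pairs `(y₀ − e_μ, μ)` (translation by `e_μ` is a bijection of the torus). [folklore] -/
theorem sum_ite_tgt_eq (y₀ : Site P 0) (c : ℝ) :
    ∑ b : PBond P 0, (if b.tgt = y₀ then c else 0) = (P.d : ℝ) * c := by
  classical
  rw [← Fintype.sum_equiv (LatticeFieldCalculus.bondEquiv (P := P) (j := 0)) (fun p => if p.1.shift p.2 = y₀ then c else 0) _ (fun _ => rfl),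
    Fintype.sum_prod_type]
  dsimp only
  rw [Finset.sum_comm]
  have hrow : ∀ μ : Fin P.d, ∑ x : Site P 0, (if x.shift μ = y₀ then c else 0) = c := by
    intro μ
    have hiff : ∀ x : Site P 0, x.shift μ = y₀ ↔ x = y₀.unshift μ := by
      intro x
      constructor
      · intro h; rw [← h, unshift_shift]
      · intro h; rw [h, shift_unshift]
    simp_rw [hiff]
    rw [Finset.sum_ite_eq' Finset.univ (y₀.unshift μ), if_pos (Finset.mem_univ _)]
  simp only [hrow, Finset.sum_const, Finset.card_univ, Fintype.card_fin, nsmul_eq_mul]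

omit [CompleteSpace 𝔸] in
/-- the size of the base-point mode `V = η⁻¹M(𝟙_{b₋=y₀} − 𝟙_{b₊=y₀})` bond by bond: `‖V b‖ ≤ |η|⁻¹‖M‖·([b₋ = y₀] + [b₊ = y₀])`. [folklore] -/
theorem norm_gaugeDir_le (η : ℝ) (y₀ : Site P 0) (M : 𝔸) (b : PBond P 0) :
    ‖(if b.src = y₀ then ((η⁻¹ : ℝ) : ℂ) • M else 0) - (if b.tgt = y₀ then ((η⁻¹ : ℝ) : ℂ) • M else 0)‖
      ≤ (if b.src = y₀ then |η|⁻¹ * ‖M‖ else 0) + (if b.tgt = y₀ then |η|⁻¹ * ‖M‖ else 0) := by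
  have hsm : ‖((η⁻¹ : ℝ) : ℂ) • M‖ ≤ |η|⁻¹ * ‖M‖ := by
    rw [norm_smul, Complex.norm_real, Real.norm_eq_abs, abs_inv]
  refine (norm_sub_le _ _).trans (add_le_add ?_ ?_)
  · split_ifs
    · exact hsm
    · simp
  · split_ifs
    · exact hsm
    · simp

/-! ## §2  ★★ The base-point bound on the column letter of a transpose of `Qlin` -/

/-- ★★ **THE COLUMN LETTER OF A TRANSPOSE OF THE SINGLE-BAR LINEARISATION IS BOUNDED BELOW BY THE BASE-POINT MODE.**  For every torus `P`, complete normed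
`ℂ`-algebra `𝔸`, nested family `D`, `η ≠ 0`, a contractive functional `τ`, the pairings `BE = (27)` (`η^d·Σ_b τ(Y_b δ_b)`) and `B` (block `τ`-pairing), any `Qt`
transposing `Qlin := fderiv ℂ (chartLog η D) 0` (`BE (Qt X) δ = B X (Qlin δ)`), any weights `w₃` on fine bonds and `wB′ ≥ 0` on index bonds and any `q₀` with the
capstone's letter `hQt'`: at every index `i` centred over `y₀` (`embIter j i₋ = y₀ ≠ embIter j i₊`) and every `m > 0` below `w₃` on the `2d` bonds at `y₀`,
**`m·‖τ(E·M)‖ ≤ 2d·|η|^{d−1}·(q₀·wB′ i)·‖E‖·‖M‖`** for all `E, M : 𝔸`.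
[cite: Balaban1985Averaging, (11) p.19, (125) p.36, (147) p.40; Balaban1985Variational, (27) p.282, (44)-(47) p.285, (88)-(90) pp.291-292] -/
theorem qt_basePoint_bound {η : ℝ} (hη : η ≠ 0) (D : Domains P)
    (τ : 𝔸 →L[ℂ] ℂ) (hτ1 : ∀ X : 𝔸, ‖τ X‖ ≤ ‖X‖)
    (BE : (PBond P 0 → 𝔸) →L[ℂ] (PBond P 0 → 𝔸) →L[ℂ] ℂ)
    (hBE : ∀ Y δ : PBond P 0 → 𝔸, BE Y δ = bondPair η P.d (τ : 𝔸 →ₗ[ℂ] ℂ) (fun μ x => Y ⟨x, μ⟩) (fun μ x => δ ⟨x, μ⟩))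
    (B : (BondIdx D → 𝔸) →L[ℂ] (BondIdx D → 𝔸) →L[ℂ] ℂ) (hB : ∀ X X' : BondIdx D → 𝔸, B X X' = ∑ t, τ (X t * X' t))
    (Qt : (BondIdx D → 𝔸) →L[ℂ] (PBond P 0 → 𝔸))
    (hQt : ∀ X δ, BE (Qt X) δ = B X (fderiv ℂ (chartLog η D : (PBond P 0 → 𝔸) → BondIdx D → 𝔸) 0 δ))
    (w₃ : PBond P 0 → ℝ) (wB' : BondIdx D → ℝ) (hwB' : ∀ i, 0 ≤ wB' i) (q₀ : ℝ)
    (hQt' : ∀ (X : BondIdx D → 𝔸) (s : ℝ), (∀ i, wB' i * ‖X i‖ ≤ s) → ∀ b, w₃ b * ‖Qt X b‖ ≤ q₀ * s)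
    (y₀ : Site P 0) (i : BondIdx D) (hsrc : embIter (i.1.1 : ℕ) i.1.2.src = y₀) (htgt : embIter (i.1.1 : ℕ) i.1.2.tgt ≠ y₀)
    {m : ℝ} (hm0 : 0 < m) (hm : ∀ b : PBond P 0, b.src = y₀ ∨ b.tgt = y₀ → m ≤ w₃ b) (E M : 𝔸) :
    m * ‖τ (E * M)‖ ≤ 2 * P.d * |η| ^ (P.d - 1) * (q₀ * wB' i) * ‖E‖ * ‖M‖ := by
  classical
  -- the one-index datum and its size
  set X : BondIdx D → 𝔸 := Pi.single i E with hX
  set s : ℝ := wB' i * ‖E‖ with hs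
  have hs0 : 0 ≤ s := mul_nonneg (hwB' i) (norm_nonneg _)
  have hXs : ∀ i', wB' i' * ‖X i'‖ ≤ s := by
    intro i'
    by_cases h : i' = i
    · subst h; simp [hX, hs]
    · rw [hX, Pi.single_eq_of_ne h, norm_zero, mul_zero]; exact hs0
  have hcol : ∀ b, w₃ b * ‖Qt X b‖ ≤ q₀ * s := hQt' X s hXs
  -- `q₀·s ≥ 0` (the letter at any bond)
  have hq0s : 0 ≤ q₀ * s := by
    obtain ⟨b₀⟩ : Nonempty (PBond P 0) := ⟨⟨y₀, ⟨0, P.hd⟩⟩⟩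
    by_contra hneg
    rw [not_le] at hneg
    have h1 := hcol ⟨y₀, ⟨0, P.hd⟩⟩
    have h2 : m ≤ w₃ ⟨y₀, ⟨0, P.hd⟩⟩ := hm _ (Or.inl rfl)
    have h3 : 0 ≤ w₃ ⟨y₀, ⟨0, P.hd⟩⟩ * ‖Qt X ⟨y₀, ⟨0, P.hd⟩⟩‖ := mul_nonneg (hm0.le.trans h2) (norm_nonneg _)
    linarith
  -- the base-point mode and the linear chart's answer `M` at `i`
  set V : PBond P 0 → 𝔸 := fun b => (if b.src = y₀ then ((η⁻¹ : ℝ) : ℂ) • M else 0) - (if b.tgt = y₀ then ((η⁻¹ : ℝ) : ℂ) • M else 0) with hV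
  have hlin : fderiv ℂ (chartLog η D : (PBond P 0 → 𝔸) → BondIdx D → 𝔸) 0 V i = M :=
    fderiv_chartLog_zero_gaugeDir_src hη D y₀ M i hsrc htgt
  -- right side of the transposition identity: `τ(E·M)`
  have hright : B X (fderiv ℂ (chartLog η D : (PBond P 0 → 𝔸) → BondIdx D → 𝔸) 0 V) = τ (E * M) := by
    rw [hB, Finset.sum_eq_single i]
    · rw [hX, Pi.single_eq_same, hlin]
    · intro t _ ht; rw [hX, Pi.single_eq_of_ne ht, zero_mul, map_zero]
    · intro h; exact absurd (Finset.mem_univ i) h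
  -- left side: `η^d·Σ_b τ((Qt X)_b V_b)`, supported on the `2d` bonds at `y₀`
  have hleft : BE (Qt X) V = (η : ℂ) ^ P.d * ∑ b : PBond P 0, τ (Qt X b * V b) := by
    rw [hBE]; exact bondPair_PBond_eq_sum η (τ : 𝔸 →ₗ[ℂ] ℂ) (Qt X) V
  have hterm : ∀ b : PBond P 0, ‖τ (Qt X b * V b)‖ ≤
      (q₀ * s / m) * ((if b.src = y₀ then |η|⁻¹ * ‖M‖ else 0) + (if b.tgt = y₀ then |η|⁻¹ * ‖M‖ else 0)) := by
    intro b
    by_cases hb : b.src = y₀ ∨ b.tgt = y₀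
    · have hwb : m ≤ w₃ b := hm b hb
      have hwb0 : 0 < w₃ b := hm0.trans_le hwb
      have hQb : ‖Qt X b‖ ≤ q₀ * s / m := by
        rw [le_div_iff₀ hm0]
        calc ‖Qt X b‖ * m ≤ ‖Qt X b‖ * w₃ b := mul_le_mul_of_nonneg_left hwb (norm_nonneg _)
          _ = w₃ b * ‖Qt X b‖ := mul_comm _ _
          _ ≤ q₀ * s := hcol b
      calc ‖τ (Qt X b * V b)‖ ≤ ‖Qt X b * V b‖ := hτ1 _
        _ ≤ ‖Qt X b‖ * ‖V b‖ := norm_mul_le _ _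
        _ ≤ (q₀ * s / m) * ((if b.src = y₀ then |η|⁻¹ * ‖M‖ else 0) + (if b.tgt = y₀ then |η|⁻¹ * ‖M‖ else 0)) :=
            mul_le_mul hQb (norm_gaugeDir_le η y₀ M b) (norm_nonneg _) (div_nonneg hq0s hm0.le)
    · rw [not_or] at hb
      have hVb : V b = 0 := by simp only [hV, if_neg hb.1, if_neg hb.2, sub_zero]
      rw [hVb, mul_zero, map_zero, norm_zero, if_neg hb.1, if_neg hb.2, add_zero, mul_zero]
  have hsum : ‖∑ b : PBond P 0, τ (Qt X b * V b)‖ ≤ (q₀ * s / m) * (2 * P.d * (|η|⁻¹ * ‖M‖)) := by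
    refine (norm_sum_le _ _).trans ((Finset.sum_le_sum fun b _ => hterm b).trans ?_)
    rw [← Finset.mul_sum, Finset.sum_add_distrib, sum_ite_src_eq, sum_ite_tgt_eq]
    apply le_of_eq; ring
  -- compare the two sides
  have hid : (η : ℂ) ^ P.d * ∑ b : PBond P 0, τ (Qt X b * V b) = τ (E * M) := by rw [← hleft, hQt, hright]
  have hηpow : ‖(η : ℂ) ^ P.d‖ = |η| ^ P.d := by rw [norm_pow, Complex.norm_real, Real.norm_eq_abs]
  have hd1 : |η| ^ P.d = |η| ^ (P.d - 1) * |η| := by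
    rw [← pow_succ]; congr 1; have := P.hd; omega
  have hη0 : 0 < |η| := abs_pos.2 hη
  calc m * ‖τ (E * M)‖ = m * (‖(η : ℂ) ^ P.d‖ * ‖∑ b : PBond P 0, τ (Qt X b * V b)‖) := by rw [← hid, norm_mul]
    _ ≤ m * (|η| ^ P.d * ((q₀ * s / m) * (2 * P.d * (|η|⁻¹ * ‖M‖)))) := by
        rw [hηpow]; exact mul_le_mul_of_nonneg_left (mul_le_mul_of_nonneg_left hsum (pow_nonneg (abs_nonneg _) _)) hm0.le
    _ = 2 * P.d * (|η| ^ (P.d - 1) * (|η| * |η|⁻¹)) * (q₀ * s) * ‖M‖ * (m / m) := by rw [hd1]; ring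
    _ = 2 * P.d * |η| ^ (P.d - 1) * (q₀ * wB' i) * ‖E‖ * ‖M‖ := by
        rw [mul_inv_cancel₀ hη0.ne', div_self hm0.ne', hs]; ring

/-- ★ **COROLLARY — UNIT WEIGHTS AT THE CENTRE, UNITAL TRACE.**  If `w₃ = 1` on the `2d` bonds at `y₀` and `τ 1 = 1`, then `1 ≤ 2d·|η|^{d−1}·(q₀·wB′ i)`; with
`η = L^{−k}`, `d = 4`: `q₀·wB′(i) ≥ L^{3k}∕8`. [cite: Balaban1985Averaging, (125) p.36, (147) p.40; Balaban1985Variational, (88)-(90) pp.291-292] -/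
theorem q0_mul_weight_ge_of_unit_weights [NormOneClass 𝔸] {η : ℝ} (hη : η ≠ 0) (D : Domains P)
    (τ : 𝔸 →L[ℂ] ℂ) (hτ1 : ∀ X : 𝔸, ‖τ X‖ ≤ ‖X‖) (hτone : τ 1 = 1)
    (BE : (PBond P 0 → 𝔸) →L[ℂ] (PBond P 0 → 𝔸) →L[ℂ] ℂ)
    (hBE : ∀ Y δ : PBond P 0 → 𝔸, BE Y δ = bondPair η P.d (τ : 𝔸 →ₗ[ℂ] ℂ) (fun μ x => Y ⟨x, μ⟩) (fun μ x => δ ⟨x, μ⟩))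
    (B : (BondIdx D → 𝔸) →L[ℂ] (BondIdx D → 𝔸) →L[ℂ] ℂ) (hB : ∀ X X' : BondIdx D → 𝔸, B X X' = ∑ t, τ (X t * X' t))
    (Qt : (BondIdx D → 𝔸) →L[ℂ] (PBond P 0 → 𝔸))
    (hQt : ∀ X δ, BE (Qt X) δ = B X (fderiv ℂ (chartLog η D : (PBond P 0 → 𝔸) → BondIdx D → 𝔸) 0 δ))
    (w₃ : PBond P 0 → ℝ) (wB' : BondIdx D → ℝ) (hwB' : ∀ i, 0 ≤ wB' i) (q₀ : ℝ)
    (hQt' : ∀ (X : BondIdx D → 𝔸) (s : ℝ), (∀ i, wB' i * ‖X i‖ ≤ s) → ∀ b, w₃ b * ‖Qt X b‖ ≤ q₀ * s)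
    (y₀ : Site P 0) (i : BondIdx D) (hsrc : embIter (i.1.1 : ℕ) i.1.2.src = y₀) (htgt : embIter (i.1.1 : ℕ) i.1.2.tgt ≠ y₀)
    (hw1 : ∀ b : PBond P 0, b.src = y₀ ∨ b.tgt = y₀ → w₃ b = 1) :
    1 ≤ 2 * P.d * |η| ^ (P.d - 1) * (q₀ * wB' i) := by
  have h := qt_basePoint_bound hη D τ hτ1 BE hBE B hB Qt hQt w₃ wB' hwB' q₀ hQt' y₀ i hsrc htgt one_pos (fun b hb => (hw1 b hb).symm.le) 1 1
  rw [one_mul, mul_one, hτone, norm_one, norm_one, mul_one, mul_one] at h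
  exact h

/-! ## §3  The record reading: P2 level weights, a centre in the top territory -/

/-- ★ **AT A CENTRE IN THE TOP TERRITORY OF THE RECORD's WEIGHTS.**  With P2's level weights `IsLevWeight P k D w` (`w m b = (L^{j(b)}η)^m`, `η = L^{−k}`, `D.k = k`),
a site `y₀` such that `y₀` and its `d` lattice predecessors `y₀ − e_μ` lie in the top territory `Ω_k` (so `w 3 = 1` on the `2d` bonds at `y₀`, k0-s1-w4's
`levWeight_eq_one_of_inOm_top`), a unital contractive `τ` (the normalised trace on `M_N(ℂ)`), and any transpose `Qt` of `Qlin` with the capstone's letter `hQt'` at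
`w₃ := w 3`: `1 ≤ 2d·((L⁻¹)^k)^{d−1}·(q₀·wB′ i)` at every index `i` centred over `y₀` — at d = 4: `q₀·wB′(i) ≥ L^{3k}∕8`, so inside the multiplier band `wB′(i)·(L^{j(i)}η) ≤ 1`
(= `wB′(i) ≤ 1` at `j(i) = k`) NO k-uniform `q₀` exists for `Q := Qlin`. [cite: Balaban1985Variational, (88)-(90) pp.291-292, (152) p.301; Balaban1985Averaging, (125) p.36, (147) p.40] -/
theorem q0_mul_weight_ge_at_top_territory [NormOneClass 𝔸] (k : ℕ) (D : Domains P) (hDk : D.k = k)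
    {w : ℕ → PBond P 0 → ℝ} (hw : IsLevWeight P k D w)
    (τ : 𝔸 →L[ℂ] ℂ) (hτ1 : ∀ X : 𝔸, ‖τ X‖ ≤ ‖X‖) (hτone : τ 1 = 1)
    (BE : (PBond P 0 → 𝔸) →L[ℂ] (PBond P 0 → 𝔸) →L[ℂ] ℂ)
    (hBE : ∀ Y δ : PBond P 0 → 𝔸, BE Y δ = bondPair (((P.L : ℝ)⁻¹) ^ k) P.d (τ : 𝔸 →ₗ[ℂ] ℂ) (fun μ x => Y ⟨x, μ⟩) (fun μ x => δ ⟨x, μ⟩))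
    (B : (BondIdx D → 𝔸) →L[ℂ] (BondIdx D → 𝔸) →L[ℂ] ℂ) (hB : ∀ X X' : BondIdx D → 𝔸, B X X' = ∑ t, τ (X t * X' t))
    (Qt : (BondIdx D → 𝔸) →L[ℂ] (PBond P 0 → 𝔸))
    (hQt : ∀ X δ, BE (Qt X) δ = B X (fderiv ℂ (chartLog (((P.L : ℝ)⁻¹) ^ k) D : (PBond P 0 → 𝔸) → BondIdx D → 𝔸) 0 δ))
    (wB' : BondIdx D → ℝ) (hwB' : ∀ i, 0 ≤ wB' i) (q₀ : ℝ)
    (hQt' : ∀ (X : BondIdx D → 𝔸) (s : ℝ), (∀ i, wB' i * ‖X i‖ ≤ s) → ∀ b, w 3 b * ‖Qt X b‖ ≤ q₀ * s)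
    (y₀ : Site P 0) (hy₀ : D.InOm k y₀) (hy₀' : ∀ μ : Fin P.d, D.InOm k (y₀.unshift μ))
    (i : BondIdx D) (hsrc : embIter (i.1.1 : ℕ) i.1.2.src = y₀) (htgt : embIter (i.1.1 : ℕ) i.1.2.tgt ≠ y₀) :
    1 ≤ 2 * P.d * (((P.L : ℝ)⁻¹) ^ k) ^ (P.d - 1) * (q₀ * wB' i) := by
  have hL0 : (0 : ℝ) < P.L := by exact_mod_cast P.L_pos
  have hη : (((P.L : ℝ)⁻¹) ^ k) ≠ 0 := by positivity
  have habs : |((P.L : ℝ)⁻¹) ^ k| = ((P.L : ℝ)⁻¹) ^ k := abs_of_pos (by positivity)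
  have hw1 : ∀ b : PBond P 0, b.src = y₀ ∨ b.tgt = y₀ → w 3 b = 1 := by
    intro b hb
    refine levWeight_eq_one_of_inOm_top hDk hw ?_ 3
    rcases hb with h | h
    · rw [h]; exact hy₀
    · -- `b₊ = y₀` ⇒ `b₋ = y₀ − e_{dir b}`
      have hs : b.src = y₀.unshift b.dir := by
        have : b.src.shift b.dir = y₀ := h
        rw [← this, unshift_shift]
      rw [hs]; exact hy₀' b.dir
  have h := q0_mul_weight_ge_of_unit_weights hη D τ hτ1 hτone BE hBE B hB Qt hQt (w 3) wB' hwB' q₀ hQt' y₀ i hsrc htgt hw1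
  rwa [habs] at h

end Summit.QuantumFields.YangMills.Theorems.K0Stub1QlinTransposeBasePoint

end
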